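import Literature.Barriers.CriticalPhenomena.PlaquetteWalkHoleRootCutMarking
import HarnessLib

/-!
# Barrier catalogue (SAWScalingLimit): THE CUT LAW AND THE MARKING LAW FOR OVER-WALKS — generic transport by the row mirror

Leaf of `PlaquetteWalkHoleRootCutMarking`. The one-live-edge criterion (`ΩG.WE_eq_excursionWinding_of_under_cut`) and the
marking law (`ΩG.kindsIn_eq_corner_corner_of_twoLive_cut`, `…coCorner_coCorner…`) are stated for UNDER-walks (first side `S`)
with a lattice cut issued from the LOWER corner `(w.1, w.2)` of the root edge. The reflection in the root row (`mirrorRow`,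
`mirrorRowFace`, `rowMirrorDom`, `ΩG.mirrorFar`) exchanges under- and over-walks, the two corners of the root edge, and the
two arc kinds of every rhombus; this file carries the cut data through the reflection once and for all, so that every
over-route cell is an instance and no mirror bookkeeping is repeated:

§0 transport of cut data: the reflection `(x, y) ↦ (x, 8·w.2 + 4 − y)` of the drawing maps lattice corners to lattice corners
(`(q.1, q.2) ↦ (q.1, 2·w.2 + 1 − q.2)`), the side segment of `(c, s)` to that of `(mirrorRowFace c, mirrorSide s)`, dead edges to
dead edges (`faces_not_mem_rowMirrorDom_iff`), and the four «beyond the domain» exits to exits.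
§1 ★★★★★ `ΩG.WE_eq_excursionWinding_of_over_cut` — THE ONE-LIVE-EDGE CRITERION FOR OVER-WALKS: hole absent; a lattice cut
`q 0 = (w.1, w.2 + 1)` (the UPPER corner of the root edge), `…, q K` ending beyond the domain, whose edges are neither the hole's
`W` side nor the root edge and no two of which are live ⇒ no wound class-`B2a` OVER-walk (first side `N`).
§2 the marking law in WOUND form for under-walks (`…_of_twoLive_cut_of_wound`, either orientation of the witness) and
★★★★★ for OVER-walks (`ΩG.kindsIn_eq_corner_corner_of_twoLive_cut_over`, `…coCorner_coCorner…_over`): exactly two live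
edges of such a cut on one rhombus `g ≠ farW`, forming a corner pair (`{N,E}` or `{S,W}`) resp. a co-corner pair (`{N,W}` or
`{S,E}`) ⇒ every wound over-walk doubles `g` through two `θ`- resp. two `(π − θ)`-corners.

Not in print; venture lane «pcv-sawmu», seat b-step0 gen 29 (FINDING-YB-KILL-FORCED-ZEROS §28).

References: A. Glazman, I. Manolescu, arXiv:1708.00395v3, §1 (Fig. 1, Fig. 2), §2.1, §4.2 (lattice symmetries), Lemma 2.1
[GlazmanManolescu2019]; A. Glazman, Electron. Commun. Probab. 20 (2015) no. 86, Lemma 3.1, proof pp. 6–7 [Glazman2015WeightedSAW];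
R. Courant, H. Robbins, *What is Mathematics?* (1941/1958), Ch. V Appendix §2 (the even–odd rule) [CourantRobbins1958];
L. V. Ahlfors, *Complex Analysis* (1979), Ch. 4 §2.1 [AhlforsCA1979].
-/

noncomputable section

open Set Function Complex
open Literature.Topology.PlaneTopology

namespace Literature.Probability.RandomPlanarGeometry.SAW.YangBaxter

open Real
open Literature.Barriers.CriticalPhenomena.PlaquetteWalk (mirrorRow mirrorRowFace mirrorSide mirrorRow_side
  mirrorRowFace_mirrorRowFace mirrorRow_injective)

open private rev_firstSide rev_isB2a from Literature.Probability.RandomPlanarGeometry.YangBaxterSAWGeneralDomain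

/-! ## §0 Transport of cut data through the reflection in the root row -/

section Transport

variable (w : Face)

/-- The reflection of the drawing in the axis of the root row, on Gaussian integers: `(x, y) ↦ (x, 8·w.2 + 4 − y)` is
`z ↦ conj z + (8·w.2 + 4)·i`. [cite: GlazmanManolescu2019, §4.2 (lattice symmetries)] -/
private theorem conj_toC_add (p : ℤ × ℤ) :
    starRingEnd ℂ (toC p) + ((8 * w.2 + 4 : ℤ) : ℂ) * I = toC (p.1, 8 * w.2 + 4 - p.2) := by
  apply Complex.ext <;> simp [toC]; ring

/-- Lattice corners go to lattice corners: `cornerPt q ↦ cornerPt (q.1, 2·w.2 + 1 − q.2)`. [cite: GlazmanManolescu2019, §4.2 (lattice symmetries)] -/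
private theorem cornerPt_reflect (q : ℤ × ℤ) :
    (((cornerPt q).1, 8 * w.2 + 4 - (cornerPt q).2) : ℤ × ℤ) = cornerPt (q.1, 2 * w.2 + 1 - q.2) :=
  Prod.ext rfl (by simp only [cornerPt]; ring)

/-- The side segment of `(c, s)` goes to the side segment of `(mirrorRowFace c, mirrorSide s)`.
[cite: GlazmanManolescu2019, §4.2 (lattice symmetries), §1 Fig. 4 (z_W, z_E, z_S, z_N)] -/
private theorem sideSeg_reflect (c : Face) (s : Side) :
    segment ℝ (toC ((c.base + s.endA).1, 8 * w.2 + 4 - (c.base + s.endA).2))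
        (toC ((c.base + s.endB).1, 8 * w.2 + 4 - (c.base + s.endB).2)) =
      sideSeg (mirrorRowFace w.2 c) (mirrorSide s) := by
  obtain ⟨a, b⟩ := c
  cases s
  · rw [sideSeg, segment_symm]
    congr 2 <;> refine Prod.ext ?_ ?_ <;>
      simp only [Face.base, Side.endA, Side.endB, mirrorRowFace, mirrorSide, Prod.fst_add, Prod.snd_add] <;> ring
  · rw [sideSeg, segment_symm]
    congr 2 <;> refine Prod.ext ?_ ?_ <;>
      simp only [Face.base, Side.endA, Side.endB, mirrorRowFace, mirrorSide, Prod.fst_add, Prod.snd_add] <;> ring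
  · rw [sideSeg]
    congr 2 <;> refine Prod.ext ?_ ?_ <;>
      simp only [Face.base, Side.endA, Side.endB, mirrorRowFace, mirrorSide, Prod.fst_add, Prod.snd_add] <;> ring
  · rw [sideSeg]
    congr 2 <;> refine Prod.ext ?_ ?_ <;>
      simp only [Face.base, Side.endA, Side.endB, mirrorRowFace, mirrorSide, Prod.fst_add, Prod.snd_add] <;> ring

/-- ★ **A cut edge drawn between two lattice corners reflects to the cut edge between the reflected corners.**
[cite: GlazmanManolescu2019, §4.2 (lattice symmetries)] -/
theorem segment_cornerPt_reflect {a b : ℤ × ℤ} {c : Face} {s : Side}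
    (h : segment ℝ (toC (cornerPt a)) (toC (cornerPt b)) = sideSeg c s) :
    segment ℝ (toC (cornerPt (a.1, 2 * w.2 + 1 - a.2))) (toC (cornerPt (b.1, 2 * w.2 + 1 - b.2))) =
      sideSeg (mirrorRowFace w.2 c) (mirrorSide s) := by
  obtain ⟨R, hR⟩ : ∃ R : ℂ →ᵃ[ℝ] ℂ, ∀ z, R z = starRingEnd ℂ z + ((8 * w.2 + 4 : ℤ) : ℂ) * I :=
    ⟨conjAe.toAlgHom.toLinearMap.toAffineMap + AffineMap.const ℝ ℂ (((8 * w.2 + 4 : ℤ) : ℂ) * I), fun z => by simp⟩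
  have hRp : ∀ p : ℤ × ℤ, R (toC p) = toC (p.1, 8 * w.2 + 4 - p.2) := fun p => by rw [hR, conj_toC_add]
  have himg := congrArg (fun A : Set ℂ => R '' A) h
  simp only [sideSeg, image_segment, hRp, cornerPt_reflect] at himg
  rw [himg, sideSeg_reflect]

/-- ★ **Dead edges reflect to dead edges**: an edge of the reflected picture has a face outside the reflected domain iff the
original edge has a face outside the domain. [cite: GlazmanManolescu2019, §4.2 (lattice symmetries)] -/
theorem faces_not_mem_rowMirrorDom_iff (D : Set Face) (e : MidEdge) :
    ((mirrorRow w.2 e).faces.1 ∉ rowMirrorDom w D ∨ (mirrorRow w.2 e).faces.2 ∉ rowMirrorDom w D) ↔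
      (e.faces.1 ∉ D ∨ e.faces.2 ∉ D) := by
  cases e with
  | vert k j =>
    have e1 : mirrorRowFace w.2 ((k - 1, 2 * w.2 - j) : Face) = (k - 1, j) :=
      Prod.ext rfl (by show 2 * w.2 - (2 * w.2 - j) = j; ring)
    have e2 : mirrorRowFace w.2 ((k, 2 * w.2 - j) : Face) = (k, j) :=
      Prod.ext rfl (by show 2 * w.2 - (2 * w.2 - j) = j; ring)
    simp only [mirrorRow, MidEdge.faces, mem_rowMirrorDom, e1, e2]
  | slant k j =>
    have e1 : mirrorRowFace w.2 ((k, 2 * w.2 + 1 - j - 1) : Face) = (k, j) :=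
      Prod.ext rfl (by show 2 * w.2 - (2 * w.2 + 1 - j - 1) = j; ring)
    have e2 : mirrorRowFace w.2 ((k, 2 * w.2 + 1 - j) : Face) = (k, j - 1) :=
      Prod.ext rfl (by show 2 * w.2 - (2 * w.2 + 1 - j) = j - 1; ring)
    simp only [mirrorRow, MidEdge.faces, mem_rowMirrorDom, e1, e2]
    exact Or.comm

/-- The reflected edge avoids the reflected side. [cite: GlazmanManolescu2019, §4.2 (lattice symmetries)] -/
private theorem mirrorRow_ne_side {g f : Face} {t x : Side} (h : g.side t ≠ f.side x) :
    (mirrorRowFace w.2 g).side (mirrorSide t) ≠ (mirrorRowFace w.2 f).side (mirrorSide x) := by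
  rw [← mirrorRow_side, ← mirrorRow_side]; exact fun h' => h (mirrorRow_injective _ h')

/-- ★ **Exits reflect to exits**: a corner beyond the domain in one of the four axis directions reflects to a corner beyond the
reflected domain. [cite: GlazmanManolescu2019, §4.2 (lattice symmetries)] [cite: AhlforsCA1979, Ch. 4 §2.1 (index of a point)] -/
theorem beyond_rowMirrorDom_of_beyond {D : Set Face} {Q : ℤ × ℤ}
    (hexit : (∀ f : Face, f ∈ D → f.1 < Q.1) ∨ (∀ f : Face, f ∈ D → Q.1 ≤ f.1) ∨
      (∀ f : Face, f ∈ D → Q.2 ≤ f.2) ∨ (∀ f : Face, f ∈ D → f.2 < Q.2)) :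
    (∀ f : Face, f ∈ rowMirrorDom w D → f.1 < Q.1) ∨ (∀ f : Face, f ∈ rowMirrorDom w D → Q.1 ≤ f.1) ∨
      (∀ f : Face, f ∈ rowMirrorDom w D → 2 * w.2 + 1 - Q.2 ≤ f.2) ∨
        (∀ f : Face, f ∈ rowMirrorDom w D → f.2 < 2 * w.2 + 1 - Q.2) := by
  rcases hexit with hD | hD | hD | hD
  · exact Or.inl fun f hf => by have := hD _ ((mem_rowMirrorDom w).1 hf); exact this
  · exact Or.inr (Or.inl fun f hf => by have := hD _ ((mem_rowMirrorDom w).1 hf); exact this)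
  · refine Or.inr (Or.inr (Or.inr fun f hf => ?_))
    have := hD _ ((mem_rowMirrorDom w).1 hf); obtain ⟨x, y⟩ := f; simp only [mirrorRowFace] at this ⊢; omega
  · refine Or.inr (Or.inr (Or.inl fun f hf => ?_))
    have := hD _ ((mem_rowMirrorDom w).1 hf); obtain ⟨x, y⟩ := f; simp only [mirrorRowFace] at this ⊢; omega

end Transport

namespace ΩG

variable {D : Set Face} {w : Face}

/-! ## §1 The one-live-edge criterion for over-walks -/

/-- ★★★★★ **THE ONE-LIVE-EDGE CRITERION FOR OVER-WALKS.** Hole absent; a lattice cut `q 0 = (w.1, w.2 + 1)` (the UPPER corner of the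
root edge), `…, q K` ending beyond the domain (in one of the four axis directions), whose edges are neither the hole's `W` side nor
the root edge, and NO TWO of whose edges `k < k'` are both live. Then every class-`B2a` OVER-walk at the far cell (first side `N`) has
its Yang–Baxter winding equal to the excursion winding (either orientation): the reflection of `WE_eq_excursionWinding_of_under_cut`.
[cite: GlazmanManolescu2019, Lemma 2.1 (statement, "in the form given in [Gl]"), §1 (Fig. 2), §4.2 (lattice symmetries)]
[cite: Glazman2015WeightedSAW, Lemma 3.1 (proof, pp. 6–7)] [cite: CourantRobbins1958, Ch. V Appendix §2 (the even–odd rule)] -/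
theorem WE_eq_excursionWinding_of_over_cut (hh : holeFaceW w ∉ D) {q : ℕ → ℤ × ℤ} {c : ℕ → Face} {s : ℕ → Side}
    {K : ℕ} (hq0 : q 0 = (w.1, w.2 + 1))
    (hseg : ∀ k, k < K → segment ℝ (toC (cornerPt (q k))) (toC (cornerPt (q (k + 1)))) = sideSeg (c k) (s k))
    (h1 : ∀ k, k < K → (c k).side (s k) ≠ (holeFaceW w).side .W) (h2 : ∀ k, k < K → (c k).side (s k) ≠ w.side .W)
    (hexit : (∀ f : Face, f ∈ D → f.1 < (q K).1) ∨ (∀ f : Face, f ∈ D → (q K).1 ≤ f.1) ∨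
      (∀ f : Face, f ∈ D → (q K).2 ≤ f.2) ∨ (∀ f : Face, f ∈ D → f.2 < (q K).2))
    (hdead : ∀ k k', k < k' → k' < K →
      (((c k).side (s k)).faces.1 ∉ D ∨ ((c k).side (s k)).faces.2 ∉ D) ∨
        (((c k').side (s k')).faces.1 ∉ D ∨ ((c k').side (s k')).faces.2 ∉ D))
    (ω : ΩG D (w.side .W) (farW w)) (hr : RootedFace D (w.side .W) (farW w)) (h : ω.IsB2a)
    (hN : ω.2.firstSideG = .N) (θ : ℝ) :
    ω.WE (fun _ => θ) = excursionWinding θ ω.2.firstSideG (ω.z1 hr h) ω.1 := by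
  by_contra hW
  have hr' := rootedFace_rowMirrorDom w hr
  have h' := ω.mirrorFar_isB2a hr h
  have hh' : holeFaceW w ∉ rowMirrorDom w D := by rwa [mem_rowMirrorDom, mirrorRowFace_holeFaceW]
  have hS' : ω.mirrorFar.2.firstSideG = .S := by rw [mirrorFar_firstSideG, hN]; rfl
  have hq0' : (((q 0).1, 2 * w.2 + 1 - (q 0).2) : ℤ × ℤ) = w := by rw [hq0]; exact Prod.ext rfl (by simp only; ring)
  refine absurd (WE_eq_excursionWinding_of_under_cut (D := rowMirrorDom w D) hh'
    (q := fun k => ((q k).1, 2 * w.2 + 1 - (q k).2)) (c := fun k => mirrorRowFace w.2 (c k))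
    (s := fun k => mirrorSide (s k)) (K := K) hq0' (fun k hk => segment_cornerPt_reflect w (hseg k hk))
    (fun k hk => ?_) (fun k hk => ?_) (beyond_rowMirrorDom_of_beyond w hexit) (fun k k' hkk hk' => ?_)
    ω.mirrorFar hr' h' hS' (π - θ)) (ω.mirrorFar_wound hr h hW)
  · have e := mirrorRow_ne_side w (h1 k hk); rwa [mirrorRowFace_holeFaceW] at e
  · have e := mirrorRow_ne_side w (h2 k hk); rwa [mirrorRowFace_self] at e
  · have e1 := (faces_not_mem_rowMirrorDom_iff w D ((c k).side (s k))).2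
    have e2 := (faces_not_mem_rowMirrorDom_iff w D ((c k').side (s k'))).2
    rw [mirrorRow_side] at e1 e2
    rcases hdead k k' hkk hk' with hd | hd
    · exact Or.inl (e1 hd)
    · exact Or.inr (e2 hd)

/-! ## §2 The marking law in wound form, and for over-walks -/

variable {ω : ΩG D (w.side .W) (farW w)}

/-- The reversed companion of a class-`B2a` walk has the same kinds off the far cell: a `[κ, κ]` list transports.
[cite: GlazmanManolescu2019, §2.1 (walks and their reversals)] [cite: Glazman2015WeightedSAW, Lemma 3.1 (proof, pp. 6–7)] -/
private theorem kindsIn_pair_of_rev_pairCO (ω : ΩG D (w.side .W) (farW w)) (hr : RootedFace D (w.side .W) (farW w))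
    (h : ω.IsB2a) {g : Face} (hg : g ≠ farW w) {κ : ArcKind} (hk : (ω.rev hr).2.kindsIn g = [κ, κ]) :
    ω.2.kindsIn g = [κ, κ] := by
  have hperm := ω.kindsIn_rev_perm hr h hg
  rw [hk] at hperm
  have hp : (ω.2.kindsIn g).Perm (List.replicate 2 κ) := hperm.symm
  exact List.perm_replicate.1 hp

/-- ★★★★ **THE MARKING LAW, wound form (corner pairs).** Under the hypotheses of `kindsIn_eq_corner_corner_of_twoLive_cut` with the
wound hypothesis `WE ≠ excursionWinding` in place of `AJ ≠ 0` (either orientation of the witness), the under-walk doubles `g` through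
two `θ`-corners. [cite: GlazmanManolescu2019, §1 (Fig. 1, the remark after eq. (1)), Lemma 2.1]
[cite: Glazman2015WeightedSAW, Lemma 3.1 (proof, pp. 6–7)] [cite: CourantRobbins1958, Ch. V Appendix §2 (the even–odd rule)] -/
theorem kindsIn_eq_corner_corner_of_twoLive_cut_of_wound (hh : holeFaceW w ∉ D) (hr : RootedFace D (w.side .W) (farW w))
    (h : ω.IsB2a) (hS : ω.2.firstSideG = .S) {q : ℕ → ℤ × ℤ} {c : ℕ → Face} {s : ℕ → Side} {K : ℕ} (hq0 : q 0 = w)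
    (hseg : ∀ k, k < K → segment ℝ (toC (cornerPt (q k))) (toC (cornerPt (q (k + 1)))) = sideSeg (c k) (s k))
    (h1 : ∀ k, k < K → (c k).side (s k) ≠ (holeFaceW w).side .W) (h2 : ∀ k, k < K → (c k).side (s k) ≠ w.side .W)
    (hexit : (∀ f : Face, f ∈ D → f.1 < (q K).1) ∨ (∀ f : Face, f ∈ D → (q K).1 ≤ f.1) ∨
      (∀ f : Face, f ∈ D → (q K).2 ≤ f.2) ∨ (∀ f : Face, f ∈ D → f.2 < (q K).2))
    {i k : ℕ} (hik : i < k)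
    (hdead : ∀ k', k' < K → k' ≠ i → k' ≠ k →
      ((c k').side (s k')).faces.1 ∉ D ∨ ((c k').side (s k')).faces.2 ∉ D)
    {g : Face} (hg : g ≠ farW w) {x y : Side}
    (hxy : (x = .N ∧ y = .E) ∨ (x = .E ∧ y = .N) ∨ (x = .S ∧ y = .W) ∨ (x = .W ∧ y = .S))
    (hci : (c i).side (s i) = g.side x) (hck : (c k).side (s k) = g.side y) {θ : ℝ}
    (hW : ω.WE (fun _ => θ) ≠ excursionWinding θ ω.2.firstSideG (ω.z1 hr h) ω.1) :
    ω.2.kindsIn g = [.corner, .corner] := by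
  rcases ω.AJ_ne_zero_or_rev_of_wound hr h θ hW with hA | hA
  · exact kindsIn_eq_corner_corner_of_twoLive_cut hh hr h hS hq0 hseg h1 h2 hexit hik hdead hg hxy hci hck hA
  · have h' := ω.rev_isB2a hr h
    have hS' : (ω.rev hr).2.firstSideG = .S := by rw [ω.rev_firstSide hr h]; exact hS
    exact kindsIn_pair_of_rev_pairCO ω hr h hg
      (kindsIn_eq_corner_corner_of_twoLive_cut hh hr h' hS' hq0 hseg h1 h2 hexit hik hdead hg hxy hci hck hA)

/-- ★★★★ **THE MARKING LAW, wound form (co-corner pairs).** As `kindsIn_eq_coCorner_coCorner_of_twoLive_cut`, with the wound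
hypothesis in place of `AJ ≠ 0`: the under-walk doubles `g` through two `(π − θ)`-corners.
[cite: GlazmanManolescu2019, §1 (Fig. 2 («if θ = π/3, then w₂ = 0»)), Lemma 2.1]
[cite: Glazman2015WeightedSAW, Lemma 3.1 (proof, pp. 6–7)] [cite: CourantRobbins1958, Ch. V Appendix §2 (the even–odd rule)] -/
theorem kindsIn_eq_coCorner_coCorner_of_twoLive_cut_of_wound (hh : holeFaceW w ∉ D)
    (hr : RootedFace D (w.side .W) (farW w)) (h : ω.IsB2a) (hS : ω.2.firstSideG = .S) {q : ℕ → ℤ × ℤ} {c : ℕ → Face}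
    {s : ℕ → Side} {K : ℕ} (hq0 : q 0 = w)
    (hseg : ∀ k, k < K → segment ℝ (toC (cornerPt (q k))) (toC (cornerPt (q (k + 1)))) = sideSeg (c k) (s k))
    (h1 : ∀ k, k < K → (c k).side (s k) ≠ (holeFaceW w).side .W) (h2 : ∀ k, k < K → (c k).side (s k) ≠ w.side .W)
    (hexit : (∀ f : Face, f ∈ D → f.1 < (q K).1) ∨ (∀ f : Face, f ∈ D → (q K).1 ≤ f.1) ∨
      (∀ f : Face, f ∈ D → (q K).2 ≤ f.2) ∨ (∀ f : Face, f ∈ D → f.2 < (q K).2))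
    {i k : ℕ} (hik : i < k)
    (hdead : ∀ k', k' < K → k' ≠ i → k' ≠ k →
      ((c k').side (s k')).faces.1 ∉ D ∨ ((c k').side (s k')).faces.2 ∉ D)
    {g : Face} (hg : g ≠ farW w) {x y : Side}
    (hxy : (x = .N ∧ y = .W) ∨ (x = .W ∧ y = .N) ∨ (x = .S ∧ y = .E) ∨ (x = .E ∧ y = .S))
    (hci : (c i).side (s i) = g.side x) (hck : (c k).side (s k) = g.side y) {θ : ℝ}
    (hW : ω.WE (fun _ => θ) ≠ excursionWinding θ ω.2.firstSideG (ω.z1 hr h) ω.1) :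
    ω.2.kindsIn g = [.coCorner, .coCorner] := by
  rcases ω.AJ_ne_zero_or_rev_of_wound hr h θ hW with hA | hA
  · exact kindsIn_eq_coCorner_coCorner_of_twoLive_cut hh hr h hS hq0 hseg h1 h2 hexit hik hdead hg hxy hci hck hA
  · have h' := ω.rev_isB2a hr h
    have hS' : (ω.rev hr).2.firstSideG = .S := by rw [ω.rev_firstSide hr h]; exact hS
    exact kindsIn_pair_of_rev_pairCO ω hr h hg
      (kindsIn_eq_coCorner_coCorner_of_twoLive_cut hh hr h' hS' hq0 hseg h1 h2 hexit hik hdead hg hxy hci hck hA)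

/-- A rhombus other than the far cell reflects to a rhombus other than the far cell. [cite: GlazmanManolescu2019, §4.2 (lattice symmetries)] -/
private theorem mirrorRowFace_ne_farW {g : Face} (hg : g ≠ farW w) : mirrorRowFace w.2 g ≠ farW w := by
  intro e
  apply hg
  have e' := congrArg (mirrorRowFace w.2) e
  rwa [mirrorRowFace_mirrorRowFace, mirrorRowFace_farW] at e'

/-- ★★★★★ **THE MARKING LAW FOR OVER-WALKS (corner pairs).** Hole absent; a lattice cut `q 0 = (w.1, w.2 + 1), …, q K` (from the
UPPER corner of the root edge) ending beyond the domain, edges neither the hole's `W` side nor the root edge, every edge other than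
`i < k` dead, and the edges `i`, `k` a CORNER pair of sides (`{N, E}` or `{S, W}`) of one rhombus `g ≠ farW`. Then every WOUND
class-`B2a` OVER-walk (first side `N`) doubles `g` through two `θ`-corners: `kindsIn g = [corner, corner]` — by reflection, from the
co-corner law for under-walks. [cite: GlazmanManolescu2019, §1 (Fig. 1, the remark after eq. (1)), §4.2 (lattice symmetries), Lemma 2.1]
[cite: Glazman2015WeightedSAW, Lemma 3.1 (proof, pp. 6–7)] [cite: CourantRobbins1958, Ch. V Appendix §2 (the even–odd rule)] -/
theorem kindsIn_eq_corner_corner_of_twoLive_cut_over (hh : holeFaceW w ∉ D) (hr : RootedFace D (w.side .W) (farW w))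
    (h : ω.IsB2a) (hN : ω.2.firstSideG = .N) {q : ℕ → ℤ × ℤ} {c : ℕ → Face} {s : ℕ → Side} {K : ℕ}
    (hq0 : q 0 = (w.1, w.2 + 1))
    (hseg : ∀ k, k < K → segment ℝ (toC (cornerPt (q k))) (toC (cornerPt (q (k + 1)))) = sideSeg (c k) (s k))
    (h1 : ∀ k, k < K → (c k).side (s k) ≠ (holeFaceW w).side .W) (h2 : ∀ k, k < K → (c k).side (s k) ≠ w.side .W)
    (hexit : (∀ f : Face, f ∈ D → f.1 < (q K).1) ∨ (∀ f : Face, f ∈ D → (q K).1 ≤ f.1) ∨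
      (∀ f : Face, f ∈ D → (q K).2 ≤ f.2) ∨ (∀ f : Face, f ∈ D → f.2 < (q K).2))
    {i k : ℕ} (hik : i < k)
    (hdead : ∀ k', k' < K → k' ≠ i → k' ≠ k →
      ((c k').side (s k')).faces.1 ∉ D ∨ ((c k').side (s k')).faces.2 ∉ D)
    {g : Face} (hg : g ≠ farW w) {x y : Side}
    (hxy : (x = .N ∧ y = .E) ∨ (x = .E ∧ y = .N) ∨ (x = .S ∧ y = .W) ∨ (x = .W ∧ y = .S))
    (hci : (c i).side (s i) = g.side x) (hck : (c k).side (s k) = g.side y) {θ : ℝ}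
    (hW : ω.WE (fun _ => θ) ≠ excursionWinding θ ω.2.firstSideG (ω.z1 hr h) ω.1) :
    ω.2.kindsIn g = [.corner, .corner] := by
  have hr' := rootedFace_rowMirrorDom w hr
  have h' := ω.mirrorFar_isB2a hr h
  have hh' : holeFaceW w ∉ rowMirrorDom w D := by rwa [mem_rowMirrorDom, mirrorRowFace_holeFaceW]
  have hS' : ω.mirrorFar.2.firstSideG = .S := by rw [mirrorFar_firstSideG, hN]; rfl
  have hq0' : (((q 0).1, 2 * w.2 + 1 - (q 0).2) : ℤ × ℤ) = w := by rw [hq0]; exact Prod.ext rfl (by simp only; ring)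
  have hxy' : (mirrorSide x = .N ∧ mirrorSide y = .W) ∨ (mirrorSide x = .W ∧ mirrorSide y = .N) ∨
      (mirrorSide x = .S ∧ mirrorSide y = .E) ∨ (mirrorSide x = .E ∧ mirrorSide y = .S) := by
    rcases hxy with ⟨rfl, rfl⟩ | ⟨rfl, rfl⟩ | ⟨rfl, rfl⟩ | ⟨rfl, rfl⟩
    · exact Or.inr (Or.inr (Or.inl ⟨rfl, rfl⟩))
    · exact Or.inr (Or.inr (Or.inr ⟨rfl, rfl⟩))
    · exact Or.inl ⟨rfl, rfl⟩
    · exact Or.inr (Or.inl ⟨rfl, rfl⟩)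
  have hk := kindsIn_eq_coCorner_coCorner_of_twoLive_cut_of_wound (D := rowMirrorDom w D) hh' hr' h' hS'
    (q := fun k => ((q k).1, 2 * w.2 + 1 - (q k).2)) (c := fun k => mirrorRowFace w.2 (c k))
    (s := fun k => mirrorSide (s k)) (K := K) hq0' (fun k hk => segment_cornerPt_reflect w (hseg k hk))
    (fun k hk => by have e := mirrorRow_ne_side w (h1 k hk); rwa [mirrorRowFace_holeFaceW] at e)
    (fun k hk => by have e := mirrorRow_ne_side w (h2 k hk); rwa [mirrorRowFace_self] at e)
    (beyond_rowMirrorDom_of_beyond w hexit) hik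
    (fun k' hk' hi hk => by
      have e := (faces_not_mem_rowMirrorDom_iff w D ((c k').side (s k'))).2 (hdead k' hk' hi hk)
      rwa [mirrorRow_side] at e)
    (mirrorRowFace_ne_farW hg) hxy'
    (by show (mirrorRowFace w.2 (c i)).side (mirrorSide (s i)) = _; rw [← mirrorRow_side, hci, mirrorRow_side])
    (by show (mirrorRowFace w.2 (c k)).side (mirrorSide (s k)) = _; rw [← mirrorRow_side, hck, mirrorRow_side])
    (ω.mirrorFar_wound hr h hW)
  have hk2 := ω.kindsIn_eq_corner_of_mirrorFar_coCorner hk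
  rwa [mirrorRowFace_mirrorRowFace] at hk2

/-- ★★★★★ **THE MARKING LAW FOR OVER-WALKS (co-corner pairs).** As `kindsIn_eq_corner_corner_of_twoLive_cut_over` with the two live
edges a CO-CORNER pair of sides (`{N, W}` or `{S, E}`) of `g ≠ farW`: every wound class-`B2a` over-walk doubles `g` through two
`(π − θ)`-corners, `kindsIn g = [coCorner, coCorner]` (`w₂`-kill: the weight vanishes at `θ = π/3`).
[cite: GlazmanManolescu2019, §1 (Fig. 2 («if θ = π/3, then w₂ = 0»)), §4.2 (lattice symmetries), Lemma 2.1]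
[cite: Glazman2015WeightedSAW, Lemma 3.1 (proof, pp. 6–7)] [cite: CourantRobbins1958, Ch. V Appendix §2 (the even–odd rule)] -/
theorem kindsIn_eq_coCorner_coCorner_of_twoLive_cut_over (hh : holeFaceW w ∉ D) (hr : RootedFace D (w.side .W) (farW w))
    (h : ω.IsB2a) (hN : ω.2.firstSideG = .N) {q : ℕ → ℤ × ℤ} {c : ℕ → Face} {s : ℕ → Side} {K : ℕ}
    (hq0 : q 0 = (w.1, w.2 + 1))
    (hseg : ∀ k, k < K → segment ℝ (toC (cornerPt (q k))) (toC (cornerPt (q (k + 1)))) = sideSeg (c k) (s k))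
    (h1 : ∀ k, k < K → (c k).side (s k) ≠ (holeFaceW w).side .W) (h2 : ∀ k, k < K → (c k).side (s k) ≠ w.side .W)
    (hexit : (∀ f : Face, f ∈ D → f.1 < (q K).1) ∨ (∀ f : Face, f ∈ D → (q K).1 ≤ f.1) ∨
      (∀ f : Face, f ∈ D → (q K).2 ≤ f.2) ∨ (∀ f : Face, f ∈ D → f.2 < (q K).2))
    {i k : ℕ} (hik : i < k)
    (hdead : ∀ k', k' < K → k' ≠ i → k' ≠ k →
      ((c k').side (s k')).faces.1 ∉ D ∨ ((c k').side (s k')).faces.2 ∉ D)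
    {g : Face} (hg : g ≠ farW w) {x y : Side}
    (hxy : (x = .N ∧ y = .W) ∨ (x = .W ∧ y = .N) ∨ (x = .S ∧ y = .E) ∨ (x = .E ∧ y = .S))
    (hci : (c i).side (s i) = g.side x) (hck : (c k).side (s k) = g.side y) {θ : ℝ}
    (hW : ω.WE (fun _ => θ) ≠ excursionWinding θ ω.2.firstSideG (ω.z1 hr h) ω.1) :
    ω.2.kindsIn g = [.coCorner, .coCorner] := by
  have hr' := rootedFace_rowMirrorDom w hr
  have h' := ω.mirrorFar_isB2a hr h
  have hh' : holeFaceW w ∉ rowMirrorDom w D := by rwa [mem_rowMirrorDom, mirrorRowFace_holeFaceW]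
  have hS' : ω.mirrorFar.2.firstSideG = .S := by rw [mirrorFar_firstSideG, hN]; rfl
  have hq0' : (((q 0).1, 2 * w.2 + 1 - (q 0).2) : ℤ × ℤ) = w := by rw [hq0]; exact Prod.ext rfl (by simp only; ring)
  have hxy' : (mirrorSide x = .N ∧ mirrorSide y = .E) ∨ (mirrorSide x = .E ∧ mirrorSide y = .N) ∨
      (mirrorSide x = .S ∧ mirrorSide y = .W) ∨ (mirrorSide x = .W ∧ mirrorSide y = .S) := by
    rcases hxy with ⟨rfl, rfl⟩ | ⟨rfl, rfl⟩ | ⟨rfl, rfl⟩ | ⟨rfl, rfl⟩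
    · exact Or.inr (Or.inr (Or.inl ⟨rfl, rfl⟩))
    · exact Or.inr (Or.inr (Or.inr ⟨rfl, rfl⟩))
    · exact Or.inl ⟨rfl, rfl⟩
    · exact Or.inr (Or.inl ⟨rfl, rfl⟩)
  have hk := kindsIn_eq_corner_corner_of_twoLive_cut_of_wound (D := rowMirrorDom w D) hh' hr' h' hS'
    (q := fun k => ((q k).1, 2 * w.2 + 1 - (q k).2)) (c := fun k => mirrorRowFace w.2 (c k))
    (s := fun k => mirrorSide (s k)) (K := K) hq0' (fun k hk => segment_cornerPt_reflect w (hseg k hk))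
    (fun k hk => by have e := mirrorRow_ne_side w (h1 k hk); rwa [mirrorRowFace_holeFaceW] at e)
    (fun k hk => by have e := mirrorRow_ne_side w (h2 k hk); rwa [mirrorRowFace_self] at e)
    (beyond_rowMirrorDom_of_beyond w hexit) hik
    (fun k' hk' hi hk => by
      have e := (faces_not_mem_rowMirrorDom_iff w D ((c k').side (s k'))).2 (hdead k' hk' hi hk)
      rwa [mirrorRow_side] at e)
    (mirrorRowFace_ne_farW hg) hxy'
    (by show (mirrorRowFace w.2 (c i)).side (mirrorSide (s i)) = _; rw [← mirrorRow_side, hci, mirrorRow_side])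
    (by show (mirrorRowFace w.2 (c k)).side (mirrorSide (s k)) = _; rw [← mirrorRow_side, hck, mirrorRow_side])
    (ω.mirrorFar_wound hr h hW)
  have hk2 := ω.kindsIn_eq_coCorner_of_mirrorFar_corner hk
  rwa [mirrorRowFace_mirrorRowFace] at hk2

end ΩG

end Literature.Probability.RandomPlanarGeometry.SAW.YangBaxter
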